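import Summits.QuantumFields.YangMills.Theorems.BalabanUVNodesN07DbarNearRowsTop
import HarnessLib

/-!
# N07 [B11] (= [15] = [Balaban1985Variational]) Sect. F — MODULE 97: **THE DENT-PAIR NEAR ROWS IN THE DOUBLE-BAR CURRENCY, AT THE RECORD, EVERY LETTER SUPPLIED** — for every
# level-`m` constraint bond `b` of print's (150) family `D″` with BOTH end blocks in `□_{m+1}^{(m+1)} ∖ Ω_{m+1}` (a DENT PAIR of the top cube; MODULE 79's second near case), under
# `NrmDbarWideOfRecord` (MODULE 91″): BOTH ENDS ARE CELLS OF THE WINDOW FAMILY `D̃`, so `U̿^{(m)}(U^u)♮(b) = Ū^{(m)}_{eml}(U″♮)(b)` EXACTLY (no frame), and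
# `‖U̿^{(m)}(U^u)♮(b) − 1‖ ≤ (d−1)·crad·((1+2C_L)·δ_{m+1}) + 7·t₂(δ_m) + (d+1)(L−1)·τ_rad(δ_m)` — MODULE 71's crossing ∕ within rows at the representative with the data letters of 69b″ ∕ 72 ∕ 81

Cell `pub-ymgap`, seat `pub-ymgap-dag-n07-e` g28 (FAN-OUT §N07 row s3; LANE OWNER of the K0 road chart side), MODULE 97 (INTENT-97, cell bus; plan (α⁗-W) step 4b of (c′)‴).
`--kind proof --supports stmt-QuantumFields-20541 --as helper` (K0⁷); count-neutral; THEOREMS ONLY (0 `def`).  [15] = [Balaban1985Variational]; [3] = [Balaban1985Averaging];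
[6] = [Balaban1985RegularSpaces]; [4] = [Balaban1984PropagatorsII]; [III] = [Balaban1988Convergent]; [I] = [Balaban1987RG1].

WHY.  Below the top, MODULE 77b's near class at a meeting datum consists of level-`m` dent pairs only (MODULE 79 `near_cases_meet_both`); a dent-pair end `y` has its block in the top cube
`□_{m+1}`, so `y ∈ □_m ⊆ Ω_m` strictly below the top (MODULE 79 `cubeDomains_Om_subset_meet_Om`, the meet's «hbelow»), hence `y ∈ D″.Om m ⊆ D̃.Om m` and `y` is not `D̃`-deep (its block
is off `Ω_{m+1}`): a `D̃`-CELL.  MODULE 94's cell–cell reading then needs only the dictionary at `b` (MODULE 95, from the Landau copy's reads under the two top-cube labels of the pair) and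
the representative's row: MODULE 71 `dist1_iter_crossing_le_of_twoBlocks` (crossing into the neighbouring block; parent bond a box bond of the window, its letter from the rooted top
gauge as in MODULE 96) or `dist1_iter_within_le_of_box` (both ends in one block), data letters MODULE 72 `plaqSmallOn_dentPair_iter_of_data` ∕ 81 `plaqSmallOn_dentBlock_iter_of_data`.

WHAT IS PROVED (sorry-free; axioms standard).  §1 `lamSite_wide_of_dent_end` (a dent-pair end is a `D̃`-cell).  §2 ★★★ `norm_dbar_sub_one_dent_le_of_data (F N)` — the header's bound, with
MODULE 96's hypothesis list + MODULE 75 §2's log-free guards (`2 ≤ m + 1` is NOT assumed: at `m = 0` the cube inclusion is vacuous, `Ω₀ = T`).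
HONEST SCOPE: by-name composition; every analytic input is a landed module's under its displayed hypotheses; `NrmDbarWideOfRecord`'s door is CONDITIONAL (`HThm4RecDbar`, N05-REC);
(T1)∕(T2) are the door's rows; nothing of [15]∕[6]∕[3]∕[III] ANALYSIS asserted beyond the cited lemmas; (c′)‴ NOT closed here (the `hQnear` adapter follows); K0⁷ NOT closed; N07 NOT
discharged; counts unmoved; one finite 𝕋⁴ programme at fixed ε — the route closes the conditional finite-𝕋⁴ rung `BalabanLadder.UV` ONLY; the YM mass gap (Clay) is NOT proved by any of
this; nothing continuum ∕ ℝ⁴ ∕ OS.  No `def`, no `instance`, no `notation`, no `sorry`.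

References: [15] (7) p. 278, (144) p. 300, (147)–(154) pp. 301–302, (160) p. 303; [3] (11) p. 19, (87)–(92) p. 31, (97) p. 32; [6] Lemma 1 (1.25) p. 79, (1.15) p. 78, p. 98,
(1.129)–(1.131) pp. 98–99; [4] (2.1)–(2.3) p. 224; [III] (2.2), (2.10)–(2.13) pp. 255–257; [I] (0.4), (0.11) p. 253.
-/

set_option autoImplicit false

noncomputable section

open scoped BigOperators Matrix.Norms.L2Operator

namespace Summit.QuantumFields.YangMills.BalabanUVNodes.N07DbarNearRowsDent

open Literature.MathematicalPhysics.QuantumFieldTheory.Balaban1983to89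
open Literature.MathematicalPhysics.QuantumFieldTheory.Balaban1983to89.Node00
open Literature.MathematicalPhysics.QuantumFieldTheory.Balaban1983to89.B15DeterminingSets
open T4Continuum (T4Family)
open T4AxialGaugeSmallField (castSite boxBonds boxPlaqs)
open T4AxialGaugeRooted (axialGaugeAt)
open B12GaugeOrbits021 (IsResidual iter_gaugeAct_of_isResidual)
open B15Eq177GaugeInvariance (blockLift)
open B16Sect1Backgrounds (toMS)
open B15Eq112TorusCover (cover)
open B14DomainGeom (Pt Within)
open B7Prop1Local (InBox)
open B8Eq131Cubes (box cube sqLo sqHi tLo tHi ctr crad ctr_mem)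
open B5Eq118OneStroke (iterBlockOf iterBlockOf_succ)
open B6SectADomainsV1 (Domains)
open B6SectAOperatorsV1 (BondIdx)
open B10Eq27TorusAxialLog (unitsField toUField gaugeActT)
open B12RegularSpaces111 (gaugeU expI)
open GaugeField (gaugeAct)
open ExpMeanLog (expMeanLogSU deltaSU)
open Summit.QuantumFields.Balaban3D.Carriers (radialContourData)
open Summit.QuantumFields.YangMills.Theorems.FlatCubeOpsText (Adm22)
open Summit.QuantumFields.YangMills.Theorems.Prop8Chart (emlIterU expCfg)
open Summit.QuantumFields.YangMills.Theorems.Prop8ChartDoubleBar (vframeU dbarIterU)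
open Summit.QuantumFields.YangMills.BalabanUVNodes.N07NormalisationDbarFrames (toUT)
open Summit.QuantumFields.YangMills.BalabanUVNodes.N07NormalisationDbarFramesWide (NrmDbarWideOfRecord)
open Summit.QuantumFields.YangMills.BalabanUVNodes.N07NormalisationCrossingEnds (lamSite_or_forall_block_of_lamBond_end)
open Summit.QuantumFields.YangMills.BalabanUVNodes.N07NormalisationWideRows (dist1_gaugeAct_axialGaugeAt_le_of_mem_boxBonds abs_sub_ctr_le_crad Icc_chartBox_subset_Icc_printWindow)
open Summit.QuantumFields.YangMills.BalabanUVNodes.N07ShearSizeTopBox (mem_boxBonds_of_ends_mem_box)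
open Summit.QuantumFields.YangMills.BalabanUVNodes.N07PrintWindowDataSmall (plaqSmallOn_printWindow_iter_of_data)
open Summit.QuantumFields.YangMills.BalabanUVNodes.N07ChartTopBoxDataSmall (two_mul_L_lt_sitesPerDir)
open Summit.QuantumFields.YangMills.BalabanUVNodes.N07DentBlockDataSmall (plaqSmallOn_dentBlock_iter_of_data)
open Summit.QuantumFields.YangMills.BalabanUVNodes.N07DentRowsTwoBlocks (dist1_iter_within_le_of_box)
open Summit.QuantumFields.YangMills.BalabanUVNodes.N07RadialAxialTower (radialTower_gaugeAct_blockLift)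
open Summit.QuantumFields.YangMills.BalabanUVNodes.N09AxialSelectionExists (iter_gaugeAct_blockLift)
open Summit.QuantumFields.YangMills.BalabanUVNodes.N07DataDownTheTowerBlowDown (dist1_plaqHol_iter_gaugeAct)
open Summit.QuantumFields.YangMills.BalabanUVNodes.N07NearRowsAtRecordWideClass (not_mem_genSet_of_embIter_not_mem)
open Summit.QuantumFields.YangMills.BalabanUVNodes.N07RecordDomainsAdm22 (blockSat_seqOfRecord)
open Summit.QuantumFields.YangMills.BalabanUVNodes.N07FarRowsOfTowerLetters (exists_collar_labels_of_lamBond_meet)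
open Summit.QuantumFields.YangMills.BalabanUVNodes.N07DbarCrossingEnds (lamBond_wide_of_near)
open Summit.QuantumFields.YangMills.BalabanUVNodes.N07DbarNearBondReading (norm_dbar_sub_one_le_of_cells norm_dbar_sub_one_le_of_outEnd_tgt norm_dbar_sub_one_le_of_outEnd_src)
open Summit.QuantumFields.YangMills.BalabanUVNodes.N07DbarDictionaryTransfer (emlIterU_unitsField_eq_iter_of_reads₂ emlIterU_eq_iter_apply_of_gaugeAct landau_reads_of_tower)
open Summit.QuantumFields.YangMills.BalabanUVNodes.N07DbarNearRowsTop (not_mem_genSet_of_not_mem_wideOm)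
open Summit.QuantumFields.YangMills.BalabanUVNodes.N07DentRowsTwoBlocks (dist1_iter_crossing_le_of_twoBlocks)
open Summit.QuantumFields.YangMills.BalabanUVNodes.N07DentPairDataSmall (plaqSmallOn_dentPair_iter_of_data)
open Summit.QuantumFields.YangMills.BalabanUVNodes.N07CubeTowerInsideRecordBelowTop (cubeDomains_Om_subset_meet_Om)
open Summit.QuantumFields.YangMills.BalabanUVNodes.N07NearRowsAtRecordWideClass (Icc_collar_of_inBox Icc_collar_add_e_of_inBox)
open Summit.QuantumFields.YangMills.BalabanUVNodes.N07DbarCrossingEnds (cubeDomains_Om_subset_widen)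
open B7Prop1Explicit (e e_apply)
open T4AxialGaugeSmallField (castSite_add_e)

/-! ## §1  A dent-pair end is a cell of the window family -/

section Geometry

variable {P : Params}

/-- ★ **A DENT-PAIR END IS A `D̃`-CELL** (generic): if `D₁.Om l ⊆ D₁′.Om l` for every `l`, `y ∈ (D₁ ⊓ D₂).Om l` and the block of `y` lies in `D₁.Om (l+1)` but NOT in `D₂.Om (l+1)`, then
`y` is a cell of `D₁′ ⊓ D₂` at level `l`. [cite: Balaban1984PropagatorsII, (2.1)–(2.3) p.224; Balaban1985Variational, (150) p.301] -/
theorem lamSite_meet_of_subset_of_block {D₁ D₁' D₂ : Domains P} (hsub : ∀ l, D₁.Om l ⊆ D₁'.Om l) {l : ℕ} {y : Site P l}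
    (hy : y ∈ (domainsMeet D₁ D₂).Om l) (hblk : blockOf y ∉ D₂.Om (l + 1)) : (domainsMeet D₁' D₂).LamSite l y := by
  rw [mem_domainsMeet_Om] at hy
  refine ⟨(mem_domainsMeet_Om _ _ l y).2 ⟨hsub l hy.1, hy.2⟩, fun hd => hblk ?_⟩
  rw [deep_domainsMeet_iff] at hd
  exact hd.2

end Geometry

/-! ## §2  The dent-pair near rows in the double-bar currency -/

section Record

variable (F : T4Family) (N : ℕ) [NeZero N]
set_option maxHeartbeats 400000 in
/-- ★★★ **THE DENT-PAIR NEAR ROWS OF `U̿^{(m)}(U^u)♮` AT THE RECORD** (statement in the header): for every level-`m` constraint bond `b` of `D″` at a meeting, print-margin-clean datum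
`(m+1, idx)` whose two end blocks lie in `□_{m+1}^{(m+1)}` and off `Ω_{m+1}`, `‖U̿^{(m)}(U^u)♮(b) − 1‖ ≤ (d−1)·crad·((1+2C_L)·δ_{m+1}) + 7·t₂(δ_m) + (d+1)(L−1)·τ_rad(δ_m)`,
`t₂(a) = (((d+2)L)²∕4)·((4(d−1)(2L−1)+1)·a)`, `τ_rad(a) = (d(L−1)+1)·((d−1)(L−1)·a)`.
[cite: Balaban1985Variational, (160) p.303, (147) p.301, (150)–(154) pp.301–302, (7) p.278; Balaban1985Averaging, (87)–(92) p.31, (97) p.32; Balaban1985RegularSpaces, Lemma 1 (1.25) p.79, (1.15) p.78, p.98, (1.129)–(1.131) pp.98–99; Balaban1984PropagatorsII, (2.1)–(2.3) p.224; Balaban1988Convergent, (2.10)–(2.13) pp.255–257] -/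
theorem norm_dbar_sub_one_dent_le_of_data {ν : Stage7Numerics} {M : ℕ} {g : ℕ → ℝ} {K k : ℕ} (s : SeqOfRecord F ν M g K k)
    (hsep : Sect2.SeqSeparated ν.M₁ s) (hkK : k ≤ (F.P K).m + (F.P K).K)
    (hgrid : ∀ j : ℕ, 1 ≤ j → j ≤ k → dCubeSide (F.P K).L M (RkOfRecord (F.P K).L ν.r (g j)) j ∣ (F.P K).sitesPerDir 0)
    {Mc ρ : ℕ} (hMc : 1 ≤ Mc) (hρ : 1 ≤ ρ) (hLρ : (F.P K).L ≤ ρ) (hfloor : (11 * (F.P K).d + 4 * ρ + Mc) * (F.P K).L + 3 ≤ ν.M₁)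
    {δ : ℕ → ℝ} {a₁ : ℝ} (hδ : ∀ n, n ≤ k → 0 < δ n ∧ δ n ≤ a₁) (hcompδ : ∀ n, n < k → δ n ≤ 2 * δ (n + 1))
    (hguard : (((((F.P K).d + 2) * (F.P K).L : ℕ) : ℝ) ^ 2 / 4) * ((4 * (((((F.P K).d - 1 : ℕ) : ℝ)) * ((2 * (F.P K).L - 1 : ℕ) : ℝ)) + 1) * a₁) < deltaSU (Fin N))
    (W : MSField (F.P K) (SU N)) (h7 : Sect2.DataSmall7PTop (avOfRecord F N K) s.Ω (suppDomOfRecord F ν K s.Ω) k δ W)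
    (U : GaugeField (F.P K) 0 (SU N)) (hfib : AgreeOn (genSet s.Ω k) (avgFamily (avOfRecord F N K) U) W)
    {m : ℕ} (hjk : m + 1 ≤ k) (hjK : m + 1 + 1 ≤ (F.P K).m + (F.P K).K) (idx : Pt (F.P K).d)
    (hmeet : ∃ x ∈ box (F.P K).L (cornerP (F.P K) Mc ρ idx) (sideP (F.P K) Mc ρ) (m + 1), ∃ y : Pt (F.P K).d, cover (F.P K) y ∈ s.Ω (m + 1) ∧ Within ((3 : ℕ) : ℤ) x y)
    (hclean : m + 1 = k ∨ ∀ z ∈ box (F.P K).L (cornerP (F.P K) Mc ρ idx - ((2 * ρ : ℕ) : Pt (F.P K).d)) (sideP (F.P K) Mc ρ + 2 * (2 * ρ)) (m + 1),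
      cover (F.P K) z ∉ s.Ω (m + 1 + 1))
    {n₀ : ℕ} (hn : ∀ κ, (tHi (cornerP (F.P K) Mc ρ idx) (sideP (F.P K) Mc ρ) ρ) κ ≤ (tLo (cornerP (F.P K) Mc ρ idx) ρ) κ + n₀) (hnN : n₀ + 1 < (F.P K).sitesPerDir (m + 1))
    -- the Landau copy `(u, A)` at the datum: the S3 door's rows (T1)∕(T2) and the dictionary budgets
    (u : GaugeTransf (F.P K) 0 (SU N)) (A : PBond (F.P K) 0 → MatA N) {κ ε' : ℝ} (hκ : 0 ≤ κ) (hε' : 0 ≤ ε')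
    (hT1 : ∀ b ∈ (Sect2.regionOfSet (F.P K) (cover (F.P K) '' cube (F.P K).L (cornerP (F.P K) Mc ρ idx) (sideP (F.P K) Mc ρ) ρ (m + 1) 0)).bonds,
      gaugeU (fun x => ιSU N (u x)) (fun b' => ιSU N (U b')) b = expI ((F.P K).eta (m + 1)) (A b))
    (hT2 : ∀ j', j' ≤ m + 1 → ∀ b ∈ (Sect2.regionOfSet (F.P K) (cover (F.P K) '' cube (F.P K).L (cornerP (F.P K) Mc ρ idx) (sideP (F.P K) Mc ρ) ρ (m + 1) j')).bonds,
      ‖A b‖ < κ * ε' * ((F.P K).L : ℝ) ^ (m + 1 - j'))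
    (hbud : 12800 * ((((F.P K).d + 2) * (F.P K).L : ℕ) : ℝ) ^ 2 * (κ * ε' * ((F.P K).L : ℝ)) ≤ 1)
    (hgd : 60 * ((((F.P K).d + 2) * (F.P K).L : ℕ) : ℝ) ^ 2 * (κ * ε' * ((F.P K).L : ℝ)) < deltaSU (Fin N))
    -- the normalisation of record (window family `D̃`)
    (hk : m + 1 ≤ (F.P K).m + (F.P K).K) (hN : NrmDbarWideOfRecord F N Mc ρ ν M g K k s U (m + 1) idx u A)
    -- the dent-pair bond of `D″`: level `m`, both end blocks in the top cube and off `Ω_{m+1}`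
    (b : PBond (F.P K) m)
    (hb : (domainsMeet (cubeDomains (F.P K) (cornerP (F.P K) Mc ρ idx) (sideP (F.P K) Mc ρ) ρ (m + 1) hk) (domainsOfSeq s.Ω (m + 1) hk)).LamBond m b)
    (hs : blockOf b.src ∈ (cubeDomains (F.P K) (cornerP (F.P K) Mc ρ idx) (sideP (F.P K) Mc ρ) ρ (m + 1) hk).Om (m + 1))
    (ht' : blockOf b.tgt ∈ (cubeDomains (F.P K) (cornerP (F.P K) Mc ρ idx) (sideP (F.P K) Mc ρ) ρ (m + 1) hk).Om (m + 1))
    (hns : blockOf b.src ∉ (domainsOfSeq s.Ω (m + 1) hk).Om (m + 1)) (hnt : blockOf b.tgt ∉ (domainsOfSeq s.Ω (m + 1) hk).Om (m + 1)) :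
    ‖((dbarIterU m (unitsField (toUField (gaugeAct u U))) b : (MatA N)ˣ) : MatA N) - 1‖ ≤
      (((F.P K).d - 1 : ℕ) : ℝ) * (crad (sideP (F.P K) Mc ρ) ρ : ℕ) *
          ((1 + 2 * ((((F.P K).L : ℝ) ^ 2 + 6 * ((((F.P K).d + 2) * (F.P K).L : ℕ) : ℝ) ^ 2) * (4 * (((((F.P K).d - 1 : ℕ) : ℝ)) * ((2 * (F.P K).L - 1 : ℕ) : ℝ)) + 1))) * δ (m + 1)) +
        7 * ((((((F.P K).d + 2) * (F.P K).L : ℕ) : ℝ) ^ 2 / 4) * ((4 * (((((F.P K).d - 1 : ℕ) : ℝ)) * ((2 * (F.P K).L - 1 : ℕ) : ℝ)) + 1) * δ m)) +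
        ((((F.P K).d + 1) * ((F.P K).L - 1) : ℕ) : ℝ) *
          ((((F.P K).d * ((F.P K).L - 1) + 1 : ℕ) : ℝ) * (((((F.P K).d - 1 : ℕ) : ℝ) * (((F.P K).L - 1 : ℕ) : ℝ)) * δ m)) := by
  -- ### letters
  have hCL0 : (0 : ℝ) ≤ 1 + 2 * ((((F.P K).L : ℝ) ^ 2 + 6 * ((((F.P K).d + 2) * (F.P K).L : ℕ) : ℝ) ^ 2) *
      (4 * (((((F.P K).d - 1 : ℕ) : ℝ)) * ((2 * (F.P K).L - 1 : ℕ) : ℝ)) + 1)) := by positivity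
  have hδj : 0 < δ (m + 1) := (hδ (m + 1) hjk).1
  have hδm : 0 < δ m := (hδ m (by omega)).1
  have hδma : δ m ≤ a₁ := (hδ m (by omega)).2
  have hX0 : (0 : ℝ) ≤ (((F.P K).d - 1 : ℕ) : ℝ) * (crad (sideP (F.P K) Mc ρ) ρ : ℕ) := by positivity
  have hr0 : (0 : ℝ) ≤ (((F.P K).d - 1 : ℕ) : ℝ) * (crad (sideP (F.P K) Mc ρ) ρ : ℕ) *
      ((1 + 2 * ((((F.P K).L : ℝ) ^ 2 + 6 * ((((F.P K).d + 2) * (F.P K).L : ℕ) : ℝ) ^ 2) * (4 * (((((F.P K).d - 1 : ℕ) : ℝ)) * ((2 * (F.P K).L - 1 : ℕ) : ℝ)) + 1))) * δ (m + 1)) :=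
    mul_nonneg hX0 (mul_nonneg hCL0 hδj.le)
  have ht20 : (0 : ℝ) ≤ 7 * ((((((F.P K).d + 2) * (F.P K).L : ℕ) : ℝ) ^ 2 / 4) * ((4 * (((((F.P K).d - 1 : ℕ) : ℝ)) * ((2 * (F.P K).L - 1 : ℕ) : ℝ)) + 1) * δ m)) := by
    positivity
  have hτ0 : (0 : ℝ) ≤ (((F.P K).d * ((F.P K).L - 1) + 1 : ℕ) : ℝ) * (((((F.P K).d - 1 : ℕ) : ℝ) * (((F.P K).L - 1 : ℕ) : ℝ)) * δ m) := by positivity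
  have hdL0 : (0 : ℝ) ≤ ((((F.P K).d + 1) * ((F.P K).L - 1) : ℕ) : ℝ) := by positivity
  have hdL1 : (1 : ℝ) ≤ ((((F.P K).d + 1) * ((F.P K).L - 1) : ℕ) : ℝ) := by
    have hd : 1 ≤ (F.P K).d := (F.P K).hd
    have hL : 2 ≤ (F.P K).L := by have := (F.P K).hL.2; omega
    have : 1 ≤ ((F.P K).d + 1) * ((F.P K).L - 1) := Nat.one_le_iff_ne_zero.mpr (Nat.mul_ne_zero (by omega) (by omega))
    exact_mod_cast this
  have ht2g : (((((F.P K).d + 2) * (F.P K).L : ℕ) : ℝ) ^ 2 / 4) * ((4 * (((((F.P K).d - 1 : ℕ) : ℝ)) * ((2 * (F.P K).L - 1 : ℕ) : ℝ)) + 1) * δ m) < deltaSU (Fin N) := by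
    refine lt_of_le_of_lt ?_ hguard
    gcongr
  -- ### the witness of the normalisation and the representative (as MODULE 96)
  obtain ⟨w, hres, hax, hnorm⟩ := hN
  set Dw := domainsMeet (cubeDomains (F.P K) (cornerP (F.P K) Mc ρ idx - ((ρ : ℕ) : Pt (F.P K).d)) (sideP (F.P K) Mc ρ + 2 * ρ) ρ (m + 1) hk)
    (domainsOfSeq s.Ω (m + 1) hk) with hDw
  set h : GaugeTransf (F.P K) (m + 1) (SU N) := axialGaugeAt (Averaging.iter (avOfRecord F N K) (m + 1) (gaugeAct w U))
    (tLo (cornerP (F.P K) Mc ρ idx) ρ) (tHi (cornerP (F.P K) Mc ρ idx) (sideP (F.P K) Mc ρ) ρ) (ctr (cornerP (F.P K) Mc ρ idx) (sideP (F.P K) Mc ρ)) with hh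
  set gw : GaugeTransf (F.P K) 0 (SU N) := fun x => blockLift (m + 1) h x * w x with hgw
  have hcl : ∀ (V : (i : ℕ) → Site (F.P K) i → (Matrix (Fin N) (Fin N) ℂ)ˣ), (∀ x, V 0 x = 1) →
      (∀ (i : ℕ) (y : Site (F.P K) (i + 1)), V (i + 1) y = V i (emb y) * vframeU (dbarIterU i (unitsField (toUField (gaugeAct u U)))) y) →
      ∀ (i : ℕ) (y : Site (F.P K) i), Dw.LamSite i y → (V i y)⁻¹ * toUT (toMS u i) y = toUT (toMS gw i) y := by
    intro V hV0 hVs i y hy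
    have hik : i ≤ m + 1 := by
      have h1 := Dw.le_of_lamSite hy
      have h2 : Dw.k = min (m + 1) (m + 1) := rfl
      rw [h2, min_self] at h1
      exact h1
    exact hnorm hk V hV0 hVs i hik y hy
  set U'' : GaugeField (F.P K) 0 (SU N) := gaugeAct gw U with hU''
  have hU''2 : U'' = gaugeAct (blockLift (m + 1) h) (gaugeAct w U) := by
    rw [hU'', hgw, ← T3UnitLawGaugeInvariance.gaugeAct_gaugeAct]
  have hresid : Averaging.iter (avOfRecord F N K) (m + 1) (gaugeAct w U) = Averaging.iter (avOfRecord F N K) (m + 1) U :=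
    iter_gaugeAct_of_isResidual (avOfRecord F N K) hk hres U
  have htower : AxialGauge (radialContourData (F.P K) m (SU N)) (Averaging.iter (avOfRecord F N K) m U'') := by
    rw [hU''2]; exact radialTower_gaugeAct_blockLift F N K hk h (gaugeAct w U) hax m (Nat.lt_succ_self m)
  have htop : Averaging.iter (avOfRecord F N K) (m + 1) U'' = gaugeAct h (Averaging.iter (avOfRecord F N K) (m + 1) U) := by
    rw [hU''2, iter_gaugeAct_blockLift (avOfRecord F N K) hk h (gaugeAct w U), hresid]
  have hplaq : ∀ q : Plaq (F.P K) m, dist1 (GaugeField.plaqHol (Averaging.iter (avOfRecord F N K) m U'') q) =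
      dist1 (GaugeField.plaqHol (Averaging.iter (avOfRecord F N K) m U) q) :=
    fun q => dist1_plaqHol_iter_gaugeAct (F := F) (N := N) (K := K) (by omega : m ≤ (F.P K).m + (F.P K).K) gw U q
  -- ### the labels of the pair: `t` (source block), `t` or `t + e_μ` (target block), both in the box of `□_{m+1}^{(m+1)}`
  obtain ⟨t, htbox, htb⟩ := (mem_cubeDomains_Om_iff (by omega) le_rfl _).1 hs
  have hsrc : blockOf b.src = (castSite t : Site (F.P K) (m + 1)) := htb.symm
  have htI : t ∈ Set.Icc (sqLo (F.P K).L (cornerP (F.P K) Mc ρ idx) ρ (m + 1) (m + 1) - 1)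
      (sqHi (F.P K).L (cornerP (F.P K) Mc ρ idx) (sideP (F.P K) Mc ρ) ρ (m + 1) (m + 1) + 1) := Icc_collar_of_inBox htbox
  have htμI : t + e b.dir ∈ Set.Icc (sqLo (F.P K).L (cornerP (F.P K) Mc ρ idx) ρ (m + 1) (m + 1) - 1)
      (sqHi (F.P K).L (cornerP (F.P K) Mc ρ idx) (sideP (F.P K) Mc ρ) ρ (m + 1) (m + 1) + 1) := Icc_collar_add_e_of_inBox htbox b.dir
  have hIb : ∀ {z : Pt (F.P K).d}, z ∈ Set.Icc (sqLo (F.P K).L (cornerP (F.P K) Mc ρ idx) ρ (m + 1) (m + 1) - 1)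
      (sqHi (F.P K).L (cornerP (F.P K) Mc ρ idx) (sideP (F.P K) Mc ρ) ρ (m + 1) (m + 1) + 1) →
      InBox (sqLo (F.P K).L (cornerP (F.P K) Mc ρ idx) ρ (m + 1) (m + 1) - 1) (sqHi (F.P K).L (cornerP (F.P K) Mc ρ idx) (sideP (F.P K) Mc ρ) ρ (m + 1) (m + 1) + 1) z :=
    fun hz i => ⟨hz.1 i, hz.2 i⟩
  -- the target block is the source block or its neighbour in the bond's direction
  have htgt2 : ∃ t₂ : Pt (F.P K).d, (t₂ = t ∨ t₂ = t + e b.dir) ∧ blockOf b.tgt = (castSite t₂ : Site (F.P K) (m + 1)) := by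
    rcases blockOf_shift_or hk b.src b.dir with hsame | hshift
    · exact ⟨t, Or.inl rfl, by rw [PBond.tgt, hsame, hsrc]⟩
    · exact ⟨t + e b.dir, Or.inr rfl, by rw [PBond.tgt, hshift, hsrc, castSite_add_e]⟩
  obtain ⟨t₂, ht₂, htgt⟩ := htgt2
  have ht₂I : t₂ ∈ Set.Icc (sqLo (F.P K).L (cornerP (F.P K) Mc ρ idx) ρ (m + 1) (m + 1) - 1)
      (sqHi (F.P K).L (cornerP (F.P K) Mc ρ idx) (sideP (F.P K) Mc ρ) ρ (m + 1) (m + 1) + 1) := by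
    rcases ht₂ with rfl | rfl
    · exact htI
    · exact htμI
  -- ### the reads of the Landau copy under the two blocks of `b` (95 §3, labels at the top level)
  have hη0 : 0 ≤ (F.P K).eta (m + 1) := by unfold Params.eta; positivity
  have hpow : (m + 1) - (m + 1 - 1) = 1 := by omega
  have hηsA : (F.P K).eta (m + 1) * (κ * ε' * ((F.P K).L : ℝ)) ≤ 1 := by
    have hη1 : (F.P K).eta (m + 1) ≤ 1 := by
      unfold Params.eta
      exact pow_le_one₀ (by positivity) (inv_le_one_of_one_le₀ (by exact_mod_cast (F.P K).L_pos))
    have hℓ1 : (1 : ℝ) ≤ ((((F.P K).d + 2) * (F.P K).L : ℕ) : ℝ) := by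
      exact_mod_cast Nat.one_le_iff_ne_zero.mpr (Nat.mul_ne_zero (by omega) (by have := (F.P K).hL.2; omega))
    have hℓ2 : (1 : ℝ) ≤ ((((F.P K).d + 2) * (F.P K).L : ℕ) : ℝ) ^ 2 := one_le_pow₀ hℓ1
    have hsA0 : 0 ≤ κ * ε' * ((F.P K).L : ℝ) := by positivity
    have h1 : κ * ε' * ((F.P K).L : ℝ) ≤ 1 := by nlinarith
    nlinarith
  have hreads : ∀ b₀ : PBond (F.P K) 0, (iterBlockOf m b₀.src = b.src ∨ iterBlockOf m b₀.src = b.tgt) →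
      (iterBlockOf m b₀.tgt = b.src ∨ iterBlockOf m b₀.tgt = b.tgt) →
      ‖((unitsField (toUField (gaugeAct u U)) b₀ : (MatA N)ˣ) : MatA N) - 1‖ ≤ 2 * ((F.P K).eta (m + 1) * (κ * ε' * ((F.P K).L : ℝ))) := by
    intro b₀ hbs hbt
    have hup : ∀ x : Site (F.P K) 0, (iterBlockOf m x = b.src ∨ iterBlockOf m x = b.tgt) →
        (iterBlockOf (m + 1) x = coverAt (F.P K) (m + 1) t ∨ iterBlockOf (m + 1) x = coverAt (F.P K) (m + 1) t₂) := by
      intro x hx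
      rw [iterBlockOf_succ]
      rcases hx with h1 | h1
      · left; rw [h1, hsrc]; rfl
      · right; rw [h1, htgt]; rfl
    obtain ⟨-, h2, h3⟩ := landau_reads_of_tower (k := m + 1) hk hLρ (by omega) le_rfl U u A hη0 hT1 hT2 (hIb htI) (hIb ht₂I) b₀ (hup _ hbs) (hup _ hbt)
    rw [hpow, pow_one] at h3
    exact h3 hηsA
  -- ### the dictionary for `U^u` at `b` (level `m`), transferred to `U″`
  have hLη : ((F.P K).L : ℝ) ^ (m + 1) * (F.P K).eta (m + 1) = 1 := B12Eq115BackgroundPair.pow_mul_eta (F.P K) (m + 1)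
  have hL1 : (1 : ℝ) ≤ (F.P K).L := by exact_mod_cast (F.P K).L_pos
  have hs00 : 0 ≤ 2 * ((F.P K).eta (m + 1) * (κ * ε' * ((F.P K).L : ℝ))) := by positivity
  have hLm : ((F.P K).L : ℝ) ^ m ≤ ((F.P K).L : ℝ) ^ (m + 1) := pow_le_pow_right₀ hL1 (Nat.le_succ m)
  have hbud' : 6400 * ((((F.P K).d + 2) * (F.P K).L : ℕ) : ℝ) ^ 2 * ((F.P K).L : ℝ) ^ m * (2 * ((F.P K).eta (m + 1) * (κ * ε' * ((F.P K).L : ℝ)))) ≤ 1 := by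
    have e : 6400 * ((((F.P K).d + 2) * (F.P K).L : ℕ) : ℝ) ^ 2 * ((F.P K).L : ℝ) ^ (m + 1) * (2 * ((F.P K).eta (m + 1) * (κ * ε' * ((F.P K).L : ℝ)))) =
        12800 * ((((F.P K).d + 2) * (F.P K).L : ℕ) : ℝ) ^ 2 * (κ * ε' * ((F.P K).L : ℝ)) * (((F.P K).L : ℝ) ^ (m + 1) * (F.P K).eta (m + 1)) := by ring
    have h1 : 6400 * ((((F.P K).d + 2) * (F.P K).L : ℕ) : ℝ) ^ 2 * ((F.P K).L : ℝ) ^ m * (2 * ((F.P K).eta (m + 1) * (κ * ε' * ((F.P K).L : ℝ)))) ≤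
        6400 * ((((F.P K).d + 2) * (F.P K).L : ℕ) : ℝ) ^ 2 * ((F.P K).L : ℝ) ^ (m + 1) * (2 * ((F.P K).eta (m + 1) * (κ * ε' * ((F.P K).L : ℝ)))) :=
      mul_le_mul_of_nonneg_right (mul_le_mul_of_nonneg_left hLm (by positivity)) hs00
    rw [e, hLη, mul_one] at h1; exact h1.trans hbud
  have hgd' : 30 * ((((F.P K).d + 2) * (F.P K).L : ℕ) : ℝ) ^ 2 * ((F.P K).L : ℝ) ^ m * (2 * ((F.P K).eta (m + 1) * (κ * ε' * ((F.P K).L : ℝ)))) <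
      deltaSU (Fin N) := by
    have e : 30 * ((((F.P K).d + 2) * (F.P K).L : ℕ) : ℝ) ^ 2 * ((F.P K).L : ℝ) ^ (m + 1) * (2 * ((F.P K).eta (m + 1) * (κ * ε' * ((F.P K).L : ℝ)))) =
        60 * ((((F.P K).d + 2) * (F.P K).L : ℕ) : ℝ) ^ 2 * (κ * ε' * ((F.P K).L : ℝ)) * (((F.P K).L : ℝ) ^ (m + 1) * (F.P K).eta (m + 1)) := by ring
    have h1 : 30 * ((((F.P K).d + 2) * (F.P K).L : ℕ) : ℝ) ^ 2 * ((F.P K).L : ℝ) ^ m * (2 * ((F.P K).eta (m + 1) * (κ * ε' * ((F.P K).L : ℝ)))) ≤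
        30 * ((((F.P K).d + 2) * (F.P K).L : ℕ) : ℝ) ^ 2 * ((F.P K).L : ℝ) ^ (m + 1) * (2 * ((F.P K).eta (m + 1) * (κ * ε' * ((F.P K).L : ℝ)))) :=
      mul_le_mul_of_nonneg_right (mul_le_mul_of_nonneg_left hLm (by positivity)) hs00
    rw [e, hLη, mul_one] at h1; exact lt_of_le_of_lt h1 hgd
  have hdict := emlIterU_unitsField_eq_iter_of_reads₂ (by omega : m ≤ (F.P K).m + (F.P K).K) (gaugeAct u U) b hs00 hbud' hgd' hreads
  have hdictb : emlIterU m (unitsField (toUField (gaugeAct gw U))) b = unitsField (toUField (Averaging.iter (avOfRecord F N K) m U'')) b :=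
    emlIterU_eq_iter_apply_of_gaugeAct (avOfRecord F N K) (by omega) U u gw b (hdict m le_rfl b (fun _ hx => Or.inl hx) (fun _ hx => Or.inr hx)).1
  -- ### both ends are `D̃`-cells
  have hν1 : 1 ≤ ν.M₁ := by omega
  have hfl : 11 * (F.P K).d + 2 * ρ + Mc + 3 + 2 * ρ ≤ ν.M₁ := by
    have hL1' : 1 ≤ (F.P K).L := (F.P K).L_pos
    have : 11 * (F.P K).d + 4 * ρ + Mc ≤ (11 * (F.P K).d + 4 * ρ + Mc) * (F.P K).L := Nat.le_mul_of_pos_right _ hL1'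
    omega
  obtain ⟨x₀, hx₀, y₀, hy₀, hxy₀⟩ := hmeet
  have hcellD'' : ∀ y : Site (F.P K) m, blockOf y ∈ (cubeDomains (F.P K) (cornerP (F.P K) Mc ρ idx) (sideP (F.P K) Mc ρ) ρ (m + 1) hk).Om (m + 1) →
      y ∈ (domainsMeet (cubeDomains (F.P K) (cornerP (F.P K) Mc ρ idx) (sideP (F.P K) Mc ρ) ρ (m + 1) hk) (domainsOfSeq s.Ω (m + 1) hk)).Om m := by
    intro y hy
    have hym : y ∈ (cubeDomains (F.P K) (cornerP (F.P K) Mc ρ idx) (sideP (F.P K) Mc ρ) ρ (m + 1) hk).Om m := Domains.nested _ y hy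
    rcases Nat.eq_zero_or_pos m with hm0 | hm1
    · subst hm0
      rw [Domains.Om_zero]; exact Finset.mem_univ _
    · exact cubeDomains_Om_subset_meet_Om (P := F.P K) hν1 s hsep hρ hfl (by omega : 2 ≤ m + 1) hjk hk hx₀ hy₀ hxy₀ m hm1 (Nat.lt_succ_self m) hym
  have hsub : ∀ l, (cubeDomains (F.P K) (cornerP (F.P K) Mc ρ idx) (sideP (F.P K) Mc ρ) ρ (m + 1) hk).Om l ⊆
      (cubeDomains (F.P K) (cornerP (F.P K) Mc ρ idx - ((ρ : ℕ) : Pt (F.P K).d)) (sideP (F.P K) Mc ρ + 2 * ρ) ρ (m + 1) hk).Om l :=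
    fun l => cubeDomains_Om_subset_widen (cornerP (F.P K) Mc ρ idx) (sideP (F.P K) Mc ρ) ρ (m + 1) hk ρ l
  have hcs : Dw.LamSite m b.src := lamSite_meet_of_subset_of_block hsub (hcellD'' b.src hs) hns
  have hct : Dw.LamSite m b.tgt := lamSite_meet_of_subset_of_block hsub (hcellD'' b.tgt ht') hnt
  -- ### the representative's row at `b`
  have hNm2 : 2 * (F.P K).L < (F.P K).sitesPerDir m := two_mul_L_lt_sitesPerDir (P := F.P K) (m := m) (by omega)
  have hNm : (F.P K).L < (F.P K).sitesPerDir m := by omega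
  have hdent : (castSite t : Site (F.P K) (m + 1)) ∉ genSet s.Ω k (m + 1) := by
    have hnest : ∀ i : ℕ, 1 ≤ i → i < m + 1 → s.Ω (i + 1) ⊆ s.Ω i := fun i h1 hi => s.chain.Ω_succ_subset_Ω h1 (lt_of_lt_of_le hi hjk)
    have hsat : ∀ (j' : ℕ) (x x' : Site (F.P K) 0), 1 ≤ j' → j' ≤ m + 1 → iterBlockOf j' x = iterBlockOf j' x' → x ∈ s.Ω j' → x' ∈ s.Ω j' :=
      fun j' x x' h1 hj' => blockSat_seqOfRecord F ν M g K k hkK s hgrid j' x x' h1 (hj'.trans hjk)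
    refine not_mem_genSet_of_embIter_not_mem s.Ω (by omega) hjk fun hmem => hns ?_
    rw [hsrc]
    exact (mem_domainsOfSeq_Om_iff_centre s.Ω hk hnest hsat (by omega) le_rfl _).2 hmem
  have hdent₂ : (castSite t₂ : Site (F.P K) (m + 1)) ∉ genSet s.Ω k (m + 1) := by
    have hnest : ∀ i : ℕ, 1 ≤ i → i < m + 1 → s.Ω (i + 1) ⊆ s.Ω i := fun i h1 hi => s.chain.Ω_succ_subset_Ω h1 (lt_of_lt_of_le hi hjk)
    have hsat : ∀ (j' : ℕ) (x x' : Site (F.P K) 0), 1 ≤ j' → j' ≤ m + 1 → iterBlockOf j' x = iterBlockOf j' x' → x ∈ s.Ω j' → x' ∈ s.Ω j' :=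
      fun j' x x' h1 hj' => blockSat_seqOfRecord F ν M g K k hkK s hgrid j' x x' h1 (hj'.trans hjk)
    refine not_mem_genSet_of_embIter_not_mem s.Ω (by omega) hjk fun hmem => hnt ?_
    rw [htgt]
    exact (mem_domainsOfSeq_Om_iff_centre s.Ω hk hnest hsat (by omega) le_rfl _).2 hmem
  have hrow : dist1 (Averaging.iter (avOfRecord F N K) m U'' b) ≤
      (((F.P K).d - 1 : ℕ) : ℝ) * (crad (sideP (F.P K) Mc ρ) ρ : ℕ) *
          ((1 + 2 * ((((F.P K).L : ℝ) ^ 2 + 6 * ((((F.P K).d + 2) * (F.P K).L : ℕ) : ℝ) ^ 2) * (4 * (((((F.P K).d - 1 : ℕ) : ℝ)) * ((2 * (F.P K).L - 1 : ℕ) : ℝ)) + 1))) * δ (m + 1)) +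
        7 * ((((((F.P K).d + 2) * (F.P K).L : ℕ) : ℝ) ^ 2 / 4) * ((4 * (((((F.P K).d - 1 : ℕ) : ℝ)) * ((2 * (F.P K).L - 1 : ℕ) : ℝ)) + 1) * δ m)) +
        ((((F.P K).d + 1) * ((F.P K).L - 1) : ℕ) : ℝ) *
          ((((F.P K).d * ((F.P K).L - 1) + 1 : ℕ) : ℝ) * (((((F.P K).d - 1 : ℕ) : ℝ) * (((F.P K).L - 1 : ℕ) : ℝ)) * δ m)) := by
    rcases ht₂ with ht₂e | ht₂e
    · -- both ends in `B(castSite t)`: 81's one-block letter and 71's within row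
      rw [ht₂e] at htgt
      have hA := plaqSmallOn_dentBlock_iter_of_data F N s hsep hkK hgrid hMc hρ hfloor W h7 U hfib hjk hk idx ⟨x₀, hx₀, y₀, hy₀, hxy₀⟩ hclean _ htI hdent
      have hW : PlaqSmallOn (boxPlaqs (fun i => ((F.P K).L : ℤ) * t i) (fun i => ((F.P K).L : ℤ) * t i + (((F.P K).L : ℤ) - 1))) (δ m)
          (Averaging.iter (avOfRecord F N K) m U'') := by
        intro q hq; rw [hplaq q]; exact hA q hq
      have h := dist1_iter_within_le_of_box (by omega) U'' htower hδm.le hNm t hW b hsrc htgt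
      refine h.trans ?_
      have h1 : (((F.P K).d * ((F.P K).L - 1) + 1 : ℕ) : ℝ) * (((((F.P K).d - 1 : ℕ) : ℝ) * (((F.P K).L - 1 : ℕ) : ℝ)) * δ m) ≤
          ((((F.P K).d + 1) * ((F.P K).L - 1) : ℕ) : ℝ) * ((((F.P K).d * ((F.P K).L - 1) + 1 : ℕ) : ℝ) * (((((F.P K).d - 1 : ℕ) : ℝ) * (((F.P K).L - 1 : ℕ) : ℝ)) * δ m)) :=
        le_mul_of_one_le_left hτ0 hdL1
      linarith
    · -- crossing into `B(castSite (t + e_μ))`: 72's two-block letter, the parent's letter from the rooted top gauge (62″ §1), 71's crossing row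
      rw [ht₂e] at htgt hdent₂
      have hA := plaqSmallOn_dentPair_iter_of_data F N s hsep hkK hgrid hMc hρ hfloor W h7 U hfib hjk hk idx ⟨x₀, hx₀, y₀, hy₀, hxy₀⟩ hclean t b.dir htI htμI
        hdent hdent₂
      have hW : PlaqSmallOn (boxPlaqs (fun i => ((F.P K).L : ℤ) * t i) (fun i => ((F.P K).L : ℤ) * (t + e b.dir) i + (((F.P K).L : ℤ) - 1))) (δ m)
          (Averaging.iter (avOfRecord F N K) m U'') := by
        intro q hq; rw [hplaq q]; exact hA q hq
      -- the parent's letter `α = (d−1)·crad·δ̂`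
      have hV := plaqSmallOn_printWindow_iter_of_data F N s hsep hkK hgrid hMc hρ hfloor hδ hcompδ hguard W h7 U hfib (by omega : 1 ≤ m + 1) hjk hjK idx
        ⟨x₀, hx₀, y₀, hy₀, hxy₀⟩ hclean
      have hS1 : 1 ≤ sideP (F.P K) Mc ρ := by have := le_sideP (P := F.P K) Mc hρ; omega
      obtain ⟨hr1, hr2, -⟩ := ctr_mem (a := cornerP (F.P K) Mc ρ idx) (ρ := ρ) hS1
      have hNwrap' : ∀ κ', (tHi (cornerP (F.P K) Mc ρ idx) (sideP (F.P K) Mc ρ) ρ) κ' - (tLo (cornerP (F.P K) Mc ρ idx) ρ) κ' < (F.P K).sitesPerDir (m + 1) :=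
        fun κ' => by have := hn κ'; omega
      have hIcc := Icc_chartBox_subset_Icc_printWindow (F.P K).L (cornerP (F.P K) Mc ρ idx) (sideP (F.P K) Mc ρ) hρ (m + 1)
      have hpar : (⟨castSite t, b.dir⟩ : PBond (F.P K) (m + 1)) ∈
          boxBonds (tLo (cornerP (F.P K) Mc ρ idx) ρ) (tHi (cornerP (F.P K) Mc ρ idx) (sideP (F.P K) Mc ρ) ρ) :=
        ⟨t, (hIcc htI).1, (hIcc htμI).2, rfl⟩
      have hα : dist1 (Averaging.iter (avOfRecord F N K) (m + 1) U'' ⟨castSite t, b.dir⟩) ≤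
          (((F.P K).d - 1 : ℕ) : ℝ) * (crad (sideP (F.P K) Mc ρ) ρ : ℕ) *
            ((1 + 2 * ((((F.P K).L : ℝ) ^ 2 + 6 * ((((F.P K).d + 2) * (F.P K).L : ℕ) : ℝ) ^ 2) * (4 * (((((F.P K).d - 1 : ℕ) : ℝ)) * ((2 * (F.P K).L - 1 : ℕ) : ℝ)) + 1))) *
              δ (m + 1)) := by
        rw [htop, hh, hresid]
        exact dist1_gaugeAct_axialGaugeAt_le_of_mem_boxBonds (Averaging.iter (avOfRecord F N K) (m + 1) U) subset_rfl hV (mul_nonneg hCL0 hδj.le) hNwrap' hr1 hr2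
          (fun x hx hx' κ' => abs_sub_ctr_le_crad hS1 x hx hx' κ') hpar
      exact dist1_iter_crossing_le_of_twoBlocks hk U'' htower hδm hNm2 ht2g t b.dir hW hα b hsrc rfl htgt
  -- ### the cell–cell reading (MODULE 94)
  exact norm_dbar_sub_one_le_of_cells Dw U u gw hcl b hcs hct _ hdictb hrow

end Record

end Summit.QuantumFields.YangMills.BalabanUVNodes.N07DbarNearRowsDent

end
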